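import Summits.CriticalPhenomena.PercolationContinuityZ3.Theorems.FreeBoxPowerSaving.Negative.FreeBoxPowerSavingProfile
import Summits.CriticalPhenomena.PercolationContinuityZ3.Theorems.FreeBoxSparse.Negative.DCTFloor
import HarnessLib

/-!
# Crux `PercNonProliferation.FreeBoxPowerSaving` (stmt-CriticalPhenomena-4447), line `Sketch-r2-ideator5`
# (card `subcritical-runaway-closure`) — stub `stub_runawayClosure`

Helper file for the checked skeleton of the crux `FreeBoxPowerSaving` (route `PercNonProliferation`),
line `Sketch-r2-ideator5`.  Proves exactly the registered stub signature `stub_runawayClosure` (the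
CLOSURE LEMMA of the line: Hutchcroft's runaway argument, arXiv:2103.17013 Prop. 2.7, transplanted from
the hierarchical lattice to the free box of `ℤ³`); lands with `--supports stmt-CriticalPhenomena-4447`.

## The statement

Bond percolation `P_p` on `ℤ³`, `B(n) = box 3 n = [-n, n]³`, free-box pair sum
`S_p(n) = Σ_{x, y ∈ B(n)} P_p(x ↔ y inside B(n))` (`FreeBoxPowerSavingNegative.pairSum`),
`FA₂(p, n) = S_p(n) / |B(n)|²` (`FreeBoxPowerSavingNegative.fa2`), per-site in-box susceptibility
`s_p(n) = S_p(n) / |B(n)|`.  Fix `0 < a < 3`, `C > 0`, `n₀ ≥ 1`.  HYPOTHESIS (no last violating scale):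
for every `p < p_c` and every `n ≥ n₀` with `C n^{3-a} ≤ s_p(n)` there is `m > n` with
`C m^{3-a} ≤ s_p(m)`.  CONCLUSION: `∃ C', ∀ n ≥ 1, FA₂(p_c, n) ≤ C' n^{-a}`.

## The argument

1. `pairSum_div_card_le_chi`: below `p_c`, `s_p(n) ≤ χ(p) = Σ_z τ_p(0, z)` (tree:
   `pairSum_le_card_mul_chi`, i.e. `χ(p) < ∞` — the absurdity).
2. `violatingScale_le`: a violating scale `m` has `C m^{3-a} ≤ χ(p)`, so
   `m ≤ M := ⌈(χ(p)/C)^{1/(3-a)}⌉₊` (`Real.rpow_le_rpow`, `Real.rpow_mul`).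
3. `no_violatingScale`: descent on `M + 1 - m` (strong induction): a violating `m ≥ n₀` produces a
   violating `m' > m`, still `≤ M`, with a smaller potential — absurd; so `s_p(n) < C n^{3-a}` for all
   `p < p_c`, `n ≥ n₀`.
4. `fa2_le_of_lt`: `FA₂(p, n) = s_p(n)/|B(n)| ≤ C n^{3-a}/|B(n)| ≤ C n^{-a}` since `n³ ≤ |B(n)| = (2n+1)³`
   (`card_box_real`) and `n^{3-a} = n^{-a} n^3` (`Real.rpow_add`).
5. `fa2_criticalProbI_le`: pass to `p = p_c` by left-continuity of the cylinder polynomial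
   `p ↦ FA₂(p, n)` (tree: `freePairAverage_criticalProbI_le_of_forall_lt`).
6. Absorb `n < n₀` into the constant (tree: `of_eventually`).

No new definitions; the registered signature is `pairSum` / `fa2` unfolded, matched definitionally.
-/

noncomputable section

open MeasureTheory Filter
open Literature.Probability.Percolation Literature.Probability.LatticeModels
open Summit.CriticalPhenomena.PercolationContinuityZ3.FreeBoxPowerSavingNegative
  (pairSum fa2 pairSum_le_card_mul_chi card_box_pos card_box_real of_eventually)
open Summit.CriticalPhenomena.PercolationContinuityZ3.Theorems.FreeBoxSparse.Negative
  (freePairAverage_criticalProbI_le_of_forall_lt)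
open scoped BigOperators Topology

namespace Summit.CriticalPhenomena.PercolationContinuityZ3.FreeBoxPowerSavingLine

namespace RunawayClosure

/-- Below `p_c`, the per-site in-box susceptibility is at most the susceptibility:
`s_p(n) = S_p(n) / |B(n)| ≤ χ(p) = Σ_z τ_p(0, z)` (the ABSURDITY `χ(p) < ∞` used by the closure;
Grimmett 1999, §6 / `pairSum_le_card_mul_chi`). [folklore] -/
theorem pairSum_div_card_le_chi (p : unitInterval)
    (hp : (p : ℝ) < criticalProb (zdGraph 3) (0 : Site 3)) (n : ℕ) :
    pairSum p n / ((box 3 n).card : ℝ) ≤ ∑' z : Site 3, tau 3 p 0 z := by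
  rw [div_le_iff₀ (card_box_pos n), mul_comm]
  exact pairSum_le_card_mul_chi p hp n

/-- Below `p_c`, violating scales are bounded: if `C m^{3-a} ≤ s_p(m)` (with `a < 3`, `C > 0`) then
`C m^{3-a} ≤ χ(p)`, so `m ≤ ⌈(χ(p)/C)^{1/(3-a)}⌉₊`. [folklore] -/
theorem violatingScale_le (p : unitInterval) (hp : (p : ℝ) < criticalProb (zdGraph 3) (0 : Site 3))
    {a C : ℝ} (ha3 : a < 3) (hC : 0 < C) {m : ℕ}
    (hm : C * (m : ℝ) ^ (3 - a) ≤ pairSum p m / ((box 3 m).card : ℝ)) :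
    m ≤ ⌈((∑' z : Site 3, tau 3 p 0 z) / C) ^ (1 / (3 - a))⌉₊ := by
  have h3a : 0 < 3 - a := by linarith
  have h1 : C * (m : ℝ) ^ (3 - a) ≤ ∑' z : Site 3, tau 3 p 0 z :=
    hm.trans (pairSum_div_card_le_chi p hp m)
  have h2 : (m : ℝ) ^ (3 - a) ≤ (∑' z : Site 3, tau 3 p 0 z) / C := by
    rw [le_div_iff₀ hC, mul_comm]; exact h1
  have hm0 : (0 : ℝ) ≤ m := Nat.cast_nonneg m
  have h3 : (m : ℝ) ≤ ((∑' z : Site 3, tau 3 p 0 z) / C) ^ (1 / (3 - a)) := by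
    have := Real.rpow_le_rpow (Real.rpow_nonneg hm0 _) h2 (le_of_lt (one_div_pos.2 h3a))
    rwa [← Real.rpow_mul hm0, mul_one_div_cancel h3a.ne', Real.rpow_one] at this
  exact_mod_cast h3.trans (Nat.le_ceil _)

/-- **No violating scale below `p_c` (Hutchcroft's runaway argument, arXiv:2103.17013 Prop. 2.7, on the
free box of `ℤ³`).**  If below `p_c` a violating scale `n ≥ n₀` (`C n^{3-a} ≤ s_p(n)`) is never the
last one, then there is none: violating scales are `≤ M` (`violatingScale_le`), and descent on the
potential `M + 1 - m` (strong induction) rules them out.  Hence `s_p(n) < C n^{3-a}` for all `p < p_c`,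
`n ≥ n₀`. [folklore] -/
theorem no_violatingScale {a C : ℝ} {n₀ : ℕ} (ha3 : a < 3) (hC : 0 < C)
    (h : ∀ p : unitInterval, (p : ℝ) < criticalProb (zdGraph 3) (0 : Site 3) → ∀ n : ℕ, n₀ ≤ n →
      C * (n : ℝ) ^ (3 - a) ≤ pairSum p n / ((box 3 n).card : ℝ) →
        ∃ m : ℕ, n < m ∧ C * (m : ℝ) ^ (3 - a) ≤ pairSum p m / ((box 3 m).card : ℝ))
    (p : unitInterval) (hp : (p : ℝ) < criticalProb (zdGraph 3) (0 : Site 3)) {n : ℕ} (hn : n₀ ≤ n) :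
    pairSum p n / ((box 3 n).card : ℝ) < C * (n : ℝ) ^ (3 - a) := by
  -- every violating scale is at most `M`
  obtain ⟨M, hM⟩ : ∃ M : ℕ, ∀ m : ℕ,
      C * (m : ℝ) ^ (3 - a) ≤ pairSum p m / ((box 3 m).card : ℝ) → m ≤ M :=
    ⟨_, fun m hm => violatingScale_le p hp ha3 hC hm⟩
  -- descent on `M + 1 - m`
  have key : ∀ k : ℕ, ∀ m : ℕ, M + 1 - m = k → n₀ ≤ m →
      C * (m : ℝ) ^ (3 - a) ≤ pairSum p m / ((box 3 m).card : ℝ) → False := by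
    intro k
    induction k using Nat.strong_induction_on with
    | _ k ih =>
      intro m hk hm hv
      have hmM : m ≤ M := hM m hv
      obtain ⟨m', hmm', hv'⟩ := h p hp m hm hv
      have hM' : m' ≤ M := hM m' hv'
      have hlt : M + 1 - m' < k := by omega
      exact ih _ hlt m' rfl (le_trans hm hmm'.le) hv'
  by_contra hcon
  exact key _ n rfl hn (not_lt.1 hcon)

/-- From `s_p(n) < C n^{3-a}` (`n ≥ 1`, `C > 0`) to `FA₂(p, n) ≤ C n^{-a}`:
`FA₂ = s/|B(n)|`, `n³ ≤ |B(n)| = (2n+1)³` and `n^{3-a} = n^{-a} · n³`. [folklore] -/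
theorem fa2_le_of_lt {a C : ℝ} (hC : 0 < C) {p : unitInterval} {n : ℕ} (hn : 1 ≤ n)
    (hlt : pairSum p n / ((box 3 n).card : ℝ) < C * (n : ℝ) ^ (3 - a)) :
    fa2 p n ≤ C * (n : ℝ) ^ (-a) := by
  have hnpos : (0 : ℝ) < n := by exact_mod_cast hn
  have hc := card_box_pos n
  have hcard : (n : ℝ) ^ (3 : ℝ) ≤ ((box 3 n).card : ℝ) := by
    rw [card_box_real, show (3 : ℝ) = ((3 : ℕ) : ℝ) by norm_num, Real.rpow_natCast]
    have : (n : ℝ) ≤ 2 * n + 1 := by linarith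
    gcongr
  have hsplit : (n : ℝ) ^ (3 - a) = (n : ℝ) ^ (-a) * (n : ℝ) ^ (3 : ℝ) := by
    rw [← Real.rpow_add hnpos]; congr 1; ring
  have hna : 0 ≤ (n : ℝ) ^ (-a) := Real.rpow_nonneg hnpos.le _
  have h1 : pairSum p n / ((box 3 n).card : ℝ) ≤ C * (n : ℝ) ^ (-a) * ((box 3 n).card : ℝ) :=
    calc pairSum p n / ((box 3 n).card : ℝ) ≤ C * (n : ℝ) ^ (3 - a) := hlt.le
      _ = C * ((n : ℝ) ^ (-a) * (n : ℝ) ^ (3 : ℝ)) := by rw [hsplit]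
      _ ≤ C * ((n : ℝ) ^ (-a) * ((box 3 n).card : ℝ)) :=
          mul_le_mul_of_nonneg_left (mul_le_mul_of_nonneg_left hcard hna) hC.le
      _ = C * (n : ℝ) ^ (-a) * ((box 3 n).card : ℝ) := by ring
  unfold fa2
  rw [sq, ← div_div, div_le_iff₀ hc]
  exact h1

/-- Left-continuity transfer to `p_c`: a bound `FA₂(p, n) ≤ c` valid for all `p < p_c` holds at
`p = p_c` (`p ↦ FA₂(p, n)` is a polynomial in `p`; tree:
`freePairAverage_criticalProbI_le_of_forall_lt`). [folklore] -/
theorem fa2_criticalProbI_le {c : ℝ} {n : ℕ}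
    (h : ∀ p : unitInterval, (p : ℝ) < criticalProb (zdGraph 3) (0 : Site 3) → fa2 p n ≤ c) :
    fa2 (criticalProbI 3) n ≤ c :=
  freePairAverage_criticalProbI_le_of_forall_lt n h

/-- The closure lemma over `pairSum` / `fa2`: under the no-last-violating-scale hypothesis below `p_c`,
`FA₂(p_c, n) ≤ C' n^{-a}` for all `n ≥ 1` (steps 3–6 of the module docstring). [folklore] -/
theorem fa2_criticalProbI_powerSaving {a C : ℝ} {n₀ : ℕ} (ha : 0 < a) (ha3 : a < 3) (hC : 0 < C)
    (hn₀ : 1 ≤ n₀)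
    (h : ∀ p : unitInterval, (p : ℝ) < criticalProb (zdGraph 3) (0 : Site 3) → ∀ n : ℕ, n₀ ≤ n →
      C * (n : ℝ) ^ (3 - a) ≤ pairSum p n / ((box 3 n).card : ℝ) →
        ∃ m : ℕ, n < m ∧ C * (m : ℝ) ^ (3 - a) ≤ pairSum p m / ((box 3 m).card : ℝ)) :
    ∃ C' : ℝ, ∀ n : ℕ, 1 ≤ n → fa2 (criticalProbI 3) n ≤ C' * (n : ℝ) ^ (-a) :=
  of_eventually (p := criticalProbI 3) ha
    (eventually_atTop.2 ⟨n₀, fun _ hn => fa2_criticalProbI_le fun p hp =>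
      fa2_le_of_lt hC (hn₀.trans hn) (no_violatingScale ha3 hC h p hp hn)⟩)

end RunawayClosure

open RunawayClosure

/-- **stub_runawayClosure (the CLOSURE LEMMA of line `Sketch-r2-ideator5` of crux `FreeBoxPowerSaving`;
Hutchcroft's runaway argument, arXiv:2103.17013 Prop. 2.7, on the free box of `ℤ³`).**  If below `p_c`
no violating scale `n ≥ n₀` (`C n^{3-a} ≤ s_p(n) = S_p(n)/|B(n)|`) is the last one, the crux holds with
exponent `a`: for `p < p_c` every violating `m` has `C m^{3-a} ≤ s_p(m) ≤ χ(p)`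
(`pairSum_le_card_mul_chi`), so violating scales are bounded by `⌈(χ/C)^{1/(3-a)}⌉₊`; descent on
`M + 1 - m` shows there is none `≥ n₀`; hence `FA₂(p, n) ≤ C n^{-a}` for `p < p_c`, `n ≥ n₀`
(`|B(n)| ≥ n³`); pass to `p_c` by `freePairAverage_criticalProbI_le_of_forall_lt` and absorb `n < n₀` by
`of_eventually`.  The registered signature is `RunawayClosure.fa2_criticalProbI_powerSaving` with
`pairSum` / `fa2` unfolded. [folklore] -/
theorem stub_runawayClosure :
    ∀ (a C : ℝ) (n₀ : ℕ), 0 < a → a < 3 → 0 < C → 1 ≤ n₀ →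
      (∀ p : unitInterval, (p : ℝ) < criticalProb (zdGraph 3) (0 : Site 3) → ∀ n : ℕ, n₀ ≤ n →
        C * (n : ℝ) ^ (3 - a) ≤
          (∑ x ∈ box 3 n, ∑ y ∈ box 3 n,
            (bondPercolation (zdGraph 3) p).real (openConnIn (↑(box 3 n) : Set (Site 3)) x y)) /
            ((box 3 n).card : ℝ) →
        ∃ m : ℕ, n < m ∧ C * (m : ℝ) ^ (3 - a) ≤
          (∑ x ∈ box 3 m, ∑ y ∈ box 3 m,
            (bondPercolation (zdGraph 3) p).real (openConnIn (↑(box 3 m) : Set (Site 3)) x y)) /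
            ((box 3 m).card : ℝ)) →
      ∃ C' : ℝ, ∀ n : ℕ, 1 ≤ n →
        (∑ x ∈ box 3 n, ∑ y ∈ box 3 n,
          (bondPercolation (zdGraph 3) (criticalProbI 3)).real
            (openConnIn (↑(box 3 n) : Set (Site 3)) x y)) /
          ((box 3 n).card : ℝ) ^ 2 ≤ C' * (n : ℝ) ^ (-a) :=
  fun _ _ _ ha ha3 hC hn₀ h => fa2_criticalProbI_powerSaving ha ha3 hC hn₀ h

end Summit.CriticalPhenomena.PercolationContinuityZ3.FreeBoxPowerSavingLine

end
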